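import Summits.Ventures.LatticeQCDFlow.Scoring.U1PlaquetteCharFunPowLimit
import Summits.Ventures.LatticeQCDFlow.Scoring.U1SectorWeightFourier
import HarnessLib

/-!
# The continuum limit of the topological charge of 2-d `U(1)` lattice gauge theory: `P(Q = k) → e^{−2π²k²/v}/Σ_j e^{−2π²j²/v}`

HONEST FRAMING: exact (Metropolis-corrected) sampling algorithms for lattice gauge theory;
figures of merit are autocorrelation/cost numbers at stated couplings and volumes; no
continuum-physics claim.

Venture `LatticeQCDFlow` (cell pub-lqcd), sub-topic `Scoring`; FANOUT row 5 (`s0-sun-a`), GEN-15.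
NEW WORK of the cell (placement rule).  Theory-2's topological charge `Q = topCharge U` of compact
`U(1)` on `(ℤ/L)²` under the Wilson measure `wilsonMeasure u1Rep β` has the exact law
`P(Q = k) = g_V(2πk)/((2π)^{V−1} e^{−βV} Σ_n I_{|n|}(β)^V)` (`V = L²`;
`Scoring/U1TorusTopologicalChargeLaw.lean`, `Scoring/U1TorusPartitionFunctionBessel.lean`), with
`g_V(2πk) = (1/2π) ∫_ℝ e^{−it·2πk} F_β(t)^V dt`, `F_β(t) = ∫_{−π}^{π} e^{itθ} e^{−β(1−cos θ)} dθ`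
(`Scoring/U1SectorWeightFourier.lean`).  Here:

* `integral_cexp_mul_u1PlaqDensity` — `F_β(t) = e^{−β} C_β(t)`, `C_β(t) = ∫_{−π}^{π} cos(tθ) e^{β cos θ} dθ`
  (the sine part vanishes by parity);
* **`wilsonMeasure_topCharge_eq_charFun_integral`** — for every `L ≥ 2`, real `β`, `k ∈ ℤ`:
  `P(Q = k) = ∫_ℝ e^{−it·2πk} φ_β(t)^{L²} dt / Σ_{n∈ℤ} (I_{|n|}(β)/I₀(β))^{L²}` (as a complex
  identity), `φ_β = C_β/Z` the one-plaquette characteristic function;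
* **`tendsto_wilsonMeasure_topCharge`** — **THE CONTINUUM LIMIT**: if `β_j → ∞`, `L_j ≥ 2` and
  `L_j²/β_j → v > 0`, then for every `k ∈ ℤ`
  `P_{L_j, β_j}(Q = k) → e^{−2π²k²/v} / Σ_{j∈ℤ} e^{−2π²j²/v}`
  (numerator: the local limit theorem of `Scoring/U1PlaquetteCharFunPowLimit.lean`,
  `→ √(2π/v) e^{−2π²k²/v}`; denominator: `Σ_n (I_{|n|}/I₀)^{V} → Σ_n e^{−vn²/2} = √(2π/v) Σ_j e^{−2π²j²/v}`
  by `Scoring/TorusPartitionFunctionContinuumLimit.lean` and Jacobi).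

The limit law is the discrete Gaussian on the topological sectors with the continuum instanton
action `2π²k²/v` (`v` = area in units of the coupling); it is obtained here as an honest limit of
theory-2's Haar-measure lattice model, with no continuum object constructed.  Elementary given the
parents; nothing is cited.  No sampler values.
-/

noncomputable section

open Real MeasureTheory Set Filter Topology intervalIntegral Complex
open scoped ENNReal
open Literature.Analysis.FunctionSpaces
open Literature.MathematicalPhysics.QuantumFieldTheory
open Literature.MathematicalPhysics.QuantumLattice (u1Rep)
open Summit.Ventures.LatticeQCDFlow.Theory2.Lattice (topCharge)

namespace Summit.Ventures.LatticeQCDFlow.Scoring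

/-! ### 1. The oracle's `F_β` is `e^{−β} C_β` -/

/-- `∫_{−π}^{π} sin(tθ) e^{−β(1−cos θ)} dθ = 0` (odd integrand). -/
theorem integral_sin_mul_u1PlaqDensity (β t : ℝ) :
    ∫ θ in (-π)..π, Real.sin (t * θ) * u1PlaqDensity β θ = 0 := by
  have h := intervalIntegral.integral_comp_neg (a := -π) (b := π)
    (fun θ => Real.sin (t * θ) * u1PlaqDensity β θ)
  simp only [neg_neg] at h
  have hodd : (fun θ => Real.sin (t * -θ) * u1PlaqDensity β (-θ)) =
      fun θ => -(Real.sin (t * θ) * u1PlaqDensity β θ) := by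
    funext θ
    simp only [u1PlaqDensity, mul_neg, Real.sin_neg, Real.cos_neg, neg_mul]
  rw [hodd, intervalIntegral.integral_neg] at h
  linarith

/-- `∫_{−π}^{π} cos(tθ) e^{−β(1−cos θ)} dθ = e^{−β} C_β(t)`. -/
theorem integral_cos_mul_u1PlaqDensity (β t : ℝ) :
    ∫ θ in (-π)..π, Real.cos (t * θ) * u1PlaqDensity β θ =
      Real.exp (-β) * ∫ θ in (-π)..π, Real.cos (t * θ) * Real.exp (β * Real.cos θ) := by
  rw [← intervalIntegral.integral_const_mul]
  refine intervalIntegral.integral_congr fun θ _ => ?_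
  simp only [u1PlaqDensity]
  rw [show -(β * (1 - Real.cos θ)) = -β + β * Real.cos θ by ring, Real.exp_add]
  ring

/-- **`F_β(t) = e^{−β} C_β(t)`**: `∫_{−π}^{π} e^{itθ} e^{−β(1−cos θ)} dθ = e^{−β} ∫_{−π}^{π} cos(tθ) e^{β cos θ} dθ`. -/
theorem integral_cexp_mul_u1PlaqDensity (β t : ℝ) :
    ∫ θ in (-π)..π, cexp (↑(t * θ) * I) * (u1PlaqDensity β θ : ℂ) =
      ((Real.exp (-β) * ∫ θ in (-π)..π, Real.cos (t * θ) * Real.exp (β * Real.cos θ) : ℝ) : ℂ) := by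
  have h1 : ∀ θ : ℝ, cexp (↑(t * θ) * I) * (u1PlaqDensity β θ : ℂ) =
      ((Real.cos (t * θ) * u1PlaqDensity β θ : ℝ) : ℂ) +
        ((Real.sin (t * θ) * u1PlaqDensity β θ : ℝ) : ℂ) * I := by
    intro θ
    rw [Complex.exp_mul_I, ← Complex.ofReal_cos, ← Complex.ofReal_sin]
    push_cast
    ring
  simp_rw [h1]
  have hc1 : Continuous fun θ : ℝ => ((Real.cos (t * θ) * u1PlaqDensity β θ : ℝ) : ℂ) :=
    continuous_ofReal.comp (by unfold u1PlaqDensity; fun_prop)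
  have hc2 : Continuous fun θ : ℝ => ((Real.sin (t * θ) * u1PlaqDensity β θ : ℝ) : ℂ) * I :=
    (continuous_ofReal.comp (by unfold u1PlaqDensity; fun_prop)).mul continuous_const
  rw [intervalIntegral.integral_add (hc1.intervalIntegrable _ _) (hc2.intervalIntegrable _ _),
    intervalIntegral.integral_mul_const, intervalIntegral.integral_ofReal,
    intervalIntegral.integral_ofReal, integral_sin_mul_u1PlaqDensity, integral_cos_mul_u1PlaqDensity]
  push_cast
  ring

/-! ### 2. The law of `Q` through the characteristic function -/

variable {L : ℕ} [NeZero L]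

/-- **`P(Q = k) = ∫_ℝ e^{−it·2πk} φ_β(t)^{L²} dt / Σ_{n∈ℤ} (I_{|n|}(β)/I₀(β))^{L²}`** for `L ≥ 2`,
real `β`, `k ∈ ℤ` (complex form; `φ_β(t) = C_β(t)/Z(β)`). -/
theorem wilsonMeasure_topCharge_eq_charFun_integral (β : ℝ) (hL : 2 ≤ L) (k : ℤ) :
    (((wilsonMeasure (d := 2) (L := L) u1Rep β {U | topCharge U = k}).toReal : ℝ) : ℂ) =
      (∫ t : ℝ, cexp (-(↑(t * (2 * π * k)) * I)) *
        (((∫ x in (-π)..π, Real.cos (t * x) * Real.exp (β * Real.cos x)) /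
          (∫ x in (-π)..π, Real.exp (β * Real.cos x))) ^ (L ^ 2) : ℝ)) /
      ((∑' n : ℤ, (besselI n.natAbs β / besselI 0 β) ^ (L ^ 2) : ℝ) : ℂ) := by
  have hV : 2 ≤ L ^ 2 := by nlinarith
  have hπ : 0 < π := Real.pi_pos
  have hI0 : 0 < besselI 0 β := besselI_zero_pos β
  have hZ := integral_exp_mul_cos_neg_pi_pi_pos β
  set V := L ^ 2 with hVd
  set Z := ∫ x in (-π)..π, Real.exp (β * Real.cos x) with hZd
  set S := ∑' n : ℤ, (besselI n.natAbs β / besselI 0 β) ^ V with hS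
  set X := ∫ t : ℝ, cexp (-(↑(t * (2 * π * k)) * I)) *
    (((∫ x in (-π)..π, Real.cos (t * x) * Real.exp (β * Real.cos x)) / Z) ^ V : ℝ) with hX
  have hZeq : Z = 2 * π * besselI 0 β := by rw [hZd, integral_exp_mul_cos_neg_pi_pi]
  -- the constant `c₁ = (1/2π) (e^{−β} Z)^V = (2π)^{V−1} e^{−βV} I₀^V`
  set c₁ : ℝ := 1 / (2 * π) * (Real.exp (-β) * Z) ^ V with hc₁
  have hc₁pos : 0 < c₁ := by positivity
  -- numerator
  have hnum : (((u1SectorWeight β V k).toReal : ℝ) : ℂ) = (c₁ : ℂ) * X := by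
    rw [u1SectorWeight_eq_oracle_integral β hV k]
    simp_rw [integral_cexp_mul_u1PlaqDensity]
    have hpt : ∀ t : ℝ, cexp (-(↑(t * (2 * π * k)) * I)) *
        (((Real.exp (-β) * ∫ θ in (-π)..π, Real.cos (t * θ) * Real.exp (β * Real.cos θ) : ℝ) : ℂ)) ^ V =
        (((Real.exp (-β) * Z) ^ V : ℝ) : ℂ) * (cexp (-(↑(t * (2 * π * k)) * I)) *
          ((((∫ x in (-π)..π, Real.cos (t * x) * Real.exp (β * Real.cos x)) / Z) ^ V : ℝ) : ℂ)) := by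
      intro t
      have e : (Real.exp (-β) * ∫ θ in (-π)..π, Real.cos (t * θ) * Real.exp (β * Real.cos θ)) =
          (Real.exp (-β) * Z) * ((∫ x in (-π)..π, Real.cos (t * x) * Real.exp (β * Real.cos x)) / Z) := by
        field_simp
      rw [e]
      push_cast
      ring
    simp_rw [hpt]
    rw [MeasureTheory.integral_const_mul, Complex.real_smul, ← hX, hc₁]
    push_cast
    ring
  -- denominator
  have hden : (2 * π) ^ (V - 1) * Real.exp (-β) ^ V * ∑' n : ℤ, besselI n.natAbs β ^ V = c₁ * S := by
    have hS' : ∑' n : ℤ, besselI n.natAbs β ^ V = S * besselI 0 β ^ V := by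
      rw [hS, ← tsum_mul_right]
      exact tsum_congr fun n => by rw [div_pow, div_mul_cancel₀ _ (pow_ne_zero _ hI0.ne')]
    rw [hS', hc₁, hZeq]
    obtain ⟨m, hm⟩ : ∃ m, V = m + 1 := ⟨V - 1, by omega⟩
    rw [hm, show m + 1 - 1 = m from by omega]
    field_simp
    ring
  rw [wilsonMeasure_topCharge_toReal_eq_besselI β hL k, ← hVd, hden]
  push_cast
  rw [hnum, mul_div_mul_left _ _ (by exact_mod_cast hc₁pos.ne')]

/-! ### 3. The continuum limit -/

variable {Ls : ℕ → ℕ} [hNZ : ∀ j, NeZero (Ls j)]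

/-- **THE CONTINUUM LIMIT OF THE TOPOLOGICAL CHARGE.**  If `β_j → ∞`, `L_j ≥ 2` and `L_j²/β_j → v > 0`,
then for every `k ∈ ℤ` the probability of the sector `Q = k` under theory-2's Wilson measure of
compact `U(1)` on `(ℤ/L_j)²` converges to `e^{−2π²k²/v} / Σ_{j∈ℤ} e^{−2π²j²/v}`. -/
theorem tendsto_wilsonMeasure_topCharge {β : ℕ → ℝ} {v : ℝ} (hv0 : 0 < v) (hL : ∀ j, 2 ≤ Ls j)
    (hβ : Tendsto β atTop atTop) (hv : Tendsto (fun j => ((Ls j ^ 2 : ℕ) : ℝ) / β j) atTop (𝓝 v))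
    (k : ℤ) :
    Tendsto (fun j => (wilsonMeasure (d := 2) (L := Ls j) u1Rep (β j) {U | topCharge U = k}).toReal)
      atTop (𝓝 (Real.exp (-(2 * π ^ 2 * (k : ℝ) ^ 2 / v)) /
        ∑' m : ℤ, Real.exp (-(2 * π ^ 2 * (m : ℝ) ^ 2 / v)))) := by
  have hπ : 0 < π := Real.pi_pos
  -- the complex-valued numerator and the real denominator converge
  have hnum := tendsto_integral_cexp_mul_charFun_pow hv0 hβ hv k
  rw [integral_cexp_mul_gaussian_eq hv0 k] at hnum
  have hden := tendsto_tsum_besselI_ratio_pow hv0 hβ hv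
  rw [tsum_exp_neg_mul_sq_div_two hv0] at hden
  set θ := ∑' m : ℤ, Real.exp (-(2 * π ^ 2 * (m : ℝ) ^ 2 / v)) with hθ
  have hsq : 0 < Real.sqrt (2 * π / v) := Real.sqrt_pos.2 (by positivity)
  -- `√(2π/v) θ = Σ_n e^{−vn²/2} > 0`
  have hT : 0 < Real.sqrt (2 * π / v) * θ := by
    rw [hθ, ← tsum_exp_neg_mul_sq_div_two hv0]
    have hsum : Summable fun n : ℤ => Real.exp (-(v * (n : ℝ) ^ 2 / 2)) := by
      refine Summable.of_nonneg_of_le (fun n => (Real.exp_pos _).le) (fun n => ?_)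
        (summable_exp_neg_mul_natAbs (by positivity : 0 < v / 2))
      refine Real.exp_le_exp.2 ?_
      rw [Nat.cast_natAbs, Int.cast_abs]
      have : |(n : ℝ)| ≤ (n : ℝ) ^ 2 := by
        rw [← sq_abs]
        rcases eq_or_ne n 0 with rfl | hn
        · simp
        · have h1 : (1 : ℝ) ≤ |(n : ℝ)| := by
            rw [← Int.cast_abs]; exact_mod_cast Int.one_le_abs hn
          nlinarith
      nlinarith
    exact hsum.tsum_pos (fun n => (Real.exp_pos _).le) 0 (Real.exp_pos _)
  have hlimne : ((Real.sqrt (2 * π / v) * θ : ℝ) : ℂ) ≠ 0 := by exact_mod_cast hT.ne'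
  have hdenC := (continuous_ofReal.tendsto _).comp hden
  have hratio := hnum.div hdenC hlimne
  -- identify with the real sequence
  have hre := (Complex.continuous_re.tendsto _).comp hratio
  have e : (((Real.sqrt (2 * π / v) * Real.exp (-(2 * π ^ 2 * (k : ℝ) ^ 2 / v)) : ℝ) : ℂ) /
      ((Real.sqrt (2 * π / v) * θ : ℝ) : ℂ)).re = Real.exp (-(2 * π ^ 2 * (k : ℝ) ^ 2 / v)) / θ := by
    rw [← Complex.ofReal_div, Complex.ofReal_re, mul_div_mul_left _ _ hsq.ne']
  rw [e] at hre
  refine hre.congr fun j => ?_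
  simp only [Function.comp_def, Pi.div_apply]
  rw [← wilsonMeasure_topCharge_eq_charFun_integral (β j) (hL j) k, Complex.ofReal_re]

end Summit.Ventures.LatticeQCDFlow.Scoring
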